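import Mathlib.Logic.Equiv.Prod
import Literature.Computability.Complexity.AOWLevelMatrix
import HarnessLib

/-!
# The odd-arity certificate: Cauchy–Schwarz on the last coordinate
(Allen–O'Donnell–Witmer 2015, App. A.2)

Trunk T-CPLX-CORE (Literature/Computability/Complexity). Support file for the discharge of the
named fact `allen_odonnell_witmer_kSAT` (`AOWRefutation.lean`), deterministic part III.

For the top Fourier level `S = [k]` of a `k`-SAT instance with `k = 2r+1` ODD, the balanced split
of `AOWLevelMatrix.lean` would need `m ≫ n^{(k+1)/2}` constraints. Allen–O'Donnell–Witmer
(App. A.2) instead single out the last coordinate: writing the level-`[k]` bias as the cubic form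
`∑_{i,j ∈ [n]^r, ℓ ∈ [n]} w(i,j,ℓ) X_i X_j x̂_ℓ` (`cubicForm`; `w = oddTensor L …` are the signed
counts of constraints by scope), Cauchy–Schwarz in `ℓ` gives

  `bias² ≤ n · ∑_ℓ W_ℓ²`,  `W_ℓ = ∑_{i,j} w(i,j,ℓ) X_i X_j`,

and `∑_ℓ W_ℓ² = Yᵀ A Y + ∑_{i,j,ℓ} w(i,j,ℓ)²` EXACTLY for `±1` vectors, where `Y(i,i') = X_i X_{i'}`
and `A` is AOW's matrix (eq. (A-def)) on `[n]^r × [n]^r`,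

  `A_{(i,i'),(j,j')} = ∑_ℓ w(i,j,ℓ) w(i',j',ℓ)` if `(i,j) ≠ (i',j')`, and `0` otherwise

(`oddMatrix`, `sq_cubicForm_le`). With the trace certificate for `YᵀAY` this yields the computable
odd-level test `two_pow_mul_abs_bias_lt_of_oddCheck`.

## References

* S. R. Allen, R. O'Donnell, D. Witmer, *How to refute a random CSP*, FOCS 2015,
  arXiv:1505.04383, App. A.2 (eqs. (normal-cs), (shuffle), (A-def), (break-up-sum)).
-/

namespace Literature.Computability.Complexity

open Finset Matrix

/-! ### The abstract decoupling inequality -/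

section Decoupling

variable {I : Type} [Fintype I] {n : ℕ}

/-- The cubic form `∑_{i,j,ℓ} w(i,j,ℓ) · X_i X_j s_ℓ`. [Allen–O'Donnell–Witmer 2015, App. A.2
(`∑_T w(T) x^T` grouped by the last coordinate)] [cite: arXiv150504383, App. A.2] -/
def cubicForm (w : I → I → Fin n → ℤ) (X : I → ℤ) (s : Fin n → ℤ) : ℤ :=
  ∑ i, ∑ j, ∑ l, w i j l * (X i * X j * s l)

/-- `cubicForm` is additive in the coefficient tensor. [folklore] -/
theorem cubicForm_add (w w' : I → I → Fin n → ℤ) (X : I → ℤ) (s : Fin n → ℤ) :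
    cubicForm (w + w') X s = cubicForm w X s + cubicForm w' X s := by
  simp only [cubicForm, Pi.add_apply, add_mul, Finset.sum_add_distrib]

/-- `cubicForm 0 = 0`. [folklore] -/
@[simp] theorem cubicForm_zero (X : I → ℤ) (s : Fin n → ℤ) : cubicForm (0 : I → I → Fin n → ℤ) X s = 0 := by
  simp [cubicForm]

/-- The partial sums `W_ℓ = ∑_{i,j} w(i,j,ℓ) X_i X_j`. [Allen–O'Donnell–Witmer 2015, App. A.2
(`W_i`)] [cite: arXiv150504383, App. A.2] -/
def lastSlice (w : I → I → Fin n → ℤ) (X : I → ℤ) (l : Fin n) : ℤ :=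
  ∑ p : I × I, w p.1 p.2 l * (X p.1 * X p.2)

/-- `cubicForm w X s = ∑_ℓ s_ℓ W_ℓ`. [Allen–O'Donnell–Witmer 2015, App. A.2] [folklore] -/
theorem cubicForm_eq_sum_lastSlice (w : I → I → Fin n → ℤ) (X : I → ℤ) (s : Fin n → ℤ) :
    cubicForm w X s = ∑ l, s l * lastSlice w X l := by
  calc cubicForm w X s = ∑ i, ∑ j, ∑ l, s l * (w i j l * (X i * X j)) := by
        simp only [cubicForm]
        exact Finset.sum_congr rfl fun i _ => Finset.sum_congr rfl fun j _ =>
          Finset.sum_congr rfl fun l _ => by ring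
    _ = ∑ i, ∑ l, ∑ j, s l * (w i j l * (X i * X j)) :=
        Finset.sum_congr rfl fun i _ => Finset.sum_comm
    _ = ∑ l, ∑ i, ∑ j, s l * (w i j l * (X i * X j)) := Finset.sum_comm
    _ = ∑ l, s l * lastSlice w X l := by
        refine Finset.sum_congr rfl fun l _ => ?_
        rw [lastSlice, Fintype.sum_prod_type, Finset.mul_sum]
        exact Finset.sum_congr rfl fun i _ => by rw [Finset.mul_sum]

/-- The full Gram-type matrix `A'_{(i,i'),(j,j')} = ∑_ℓ w(i,j,ℓ) w(i',j',ℓ)` (before removing the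
`(i,j) = (i',j')` entries). [Allen–O'Donnell–Witmer 2015, App. A.2, Remark A.? (`A'`)] [cite: arXiv150504383, App. A.2] -/
def oddGram (w : I → I → Fin n → ℤ) : Matrix (I × I) (I × I) ℤ :=
  Matrix.of fun p q => ∑ l, w p.1 q.1 l * w p.2 q.2 l

/-- **AOW's matrix `A`** (eq. (A-def)): `oddGram` with the entries `(i,j) = (i',j')` set to zero.
[Allen–O'Donnell–Witmer 2015, App. A.2, eq. (A-def)] [cite: arXiv150504383, App. A.2] -/
def oddMatrix [DecidableEq I] (w : I → I → Fin n → ℤ) : Matrix (I × I) (I × I) ℤ :=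
  Matrix.of fun p q => if p.1 = p.2 ∧ q.1 = q.2 then 0 else ∑ l, w p.1 q.1 l * w p.2 q.2 l

/-- The pair-sign vector `Y(i,i') = X_i X_{i'}`. [Allen–O'Donnell–Witmer 2015, App. A.2
(`x^{⊗ k-1}`)] [cite: arXiv150504383, App. A.2] -/
def pairSignVec (X : I → ℤ) (p : I × I) : ℤ := X p.1 * X p.2

/-- `∑_ℓ W_ℓ² = Yᵀ A' Y` (re-pairing `((i,j),(i',j')) ↔ ((i,i'),(j,j'))`).
[Allen–O'Donnell–Witmer 2015, App. A.2, eq. (shuffle)] [cite: arXiv150504383, App. A.2] -/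
theorem sum_lastSlice_sq_eq (w : I → I → Fin n → ℤ) (X : I → ℤ) :
    ∑ l, lastSlice w X l ^ 2 = pairSignVec X ⬝ᵥ (oddGram w *ᵥ pairSignVec X) := by
  -- both sides as a sum over `((i,j),(i',j'))`, resp. `((i,i'),(j,j'))`
  have hL : ∑ l, lastSlice w X l ^ 2 =
      ∑ pp : (I × I) × (I × I), (∑ l, w pp.1.1 pp.1.2 l * w pp.2.1 pp.2.2 l) *
        (X pp.1.1 * X pp.1.2 * (X pp.2.1 * X pp.2.2)) := by
    simp only [lastSlice, sq, Finset.sum_mul_sum, Fintype.sum_prod_type (f := fun pp :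
      (I × I) × (I × I) => _)]
    rw [Finset.sum_comm]
    refine Finset.sum_congr rfl fun p _ => ?_
    rw [Finset.sum_comm]
    refine Finset.sum_congr rfl fun p' _ => ?_
    rw [Finset.sum_mul]
    refine Finset.sum_congr rfl fun l _ => ?_
    ring
  have hR : pairSignVec X ⬝ᵥ (oddGram w *ᵥ pairSignVec X) =
      ∑ PQ : (I × I) × (I × I), pairSignVec X PQ.1 * (oddGram w PQ.1 PQ.2 * pairSignVec X PQ.2) := by
    simp only [dotProduct, Matrix.mulVec, Finset.mul_sum, Fintype.sum_prod_type (f := fun PQ :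
      (I × I) × (I × I) => _)]
  rw [hL, hR, ← (Equiv.prodProdProdComm I I I I).sum_comp]
  refine Finset.sum_congr rfl fun pp _ => ?_
  simp only [Equiv.prodProdProdComm, Equiv.coe_fn_mk, pairSignVec, oddGram, Matrix.of_apply]
  ring

/-- The removed entries contribute exactly `∑_{i,j,ℓ} w(i,j,ℓ)²` on `±1` vectors:
`Yᵀ A Y = Yᵀ A' Y - ∑ w²`. [Allen–O'Donnell–Witmer 2015, App. A.2, eq. (break-up-sum)] [cite: arXiv150504383, App. A.2] -/
theorem dotProduct_oddMatrix_mulVec [DecidableEq I] (w : I → I → Fin n → ℤ) (X : I → ℤ)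
    (hX : ∀ i, X i ^ 2 = 1) :
    pairSignVec X ⬝ᵥ (oddMatrix w *ᵥ pairSignVec X) =
      pairSignVec X ⬝ᵥ (oddGram w *ᵥ pairSignVec X) - ∑ i, ∑ j, ∑ l, w i j l ^ 2 := by
  have hdiff : oddMatrix w = oddGram w -
      Matrix.of fun p q : I × I => if p.1 = p.2 ∧ q.1 = q.2 then oddGram w p q else 0 := by
    ext p q
    simp only [oddMatrix, oddGram, Matrix.sub_apply, Matrix.of_apply]
    split_ifs <;> simp
  rw [hdiff, Matrix.sub_mulVec, dotProduct_sub]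
  congr 1
  -- the diagonal-pattern form
  have hXX : ∀ i, X i * X i = 1 := fun i => by rw [← sq, hX]
  simp only [dotProduct, Matrix.mulVec, Matrix.of_apply, Fintype.sum_prod_type, pairSignVec]
  refine Finset.sum_congr rfl fun i _ => ?_
  -- ∑ i', X i X i' * ∑ j, ∑ j', (if i = i' ∧ j = j' then G else 0) * (X j X j') = ∑ j ∑ l w²
  have hinner : ∀ i' : I, (∑ j, ∑ j', (if i = i' ∧ j = j' then oddGram w (i, i') (j, j') else 0) *
      (X j * X j')) = if i = i' then ∑ j, oddGram w (i, i) (j, j) else 0 := by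
    intro i'
    split_ifs with h
    · subst h
      simp only [true_and]
      refine Finset.sum_congr rfl fun j _ => ?_
      rw [Finset.sum_eq_single j (fun j' _ hne => by rw [if_neg (Ne.symm hne), zero_mul])
        (fun h => absurd (Finset.mem_univ j) h), if_pos rfl, hXX, mul_one]
    · simp [h]
  simp_rw [hinner]
  rw [Finset.sum_eq_single i (fun i' _ hne => by rw [if_neg (Ne.symm hne), mul_zero])
    (fun h => absurd (Finset.mem_univ i) h), if_pos rfl, hXX, one_mul]
  refine Finset.sum_congr rfl fun j _ => ?_
  simp only [oddGram, Matrix.of_apply, sq]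

/-- **The decoupling inequality** (Cauchy–Schwarz on the last coordinate): for `±1` vectors
`X`, `s`,  `(∑_{i,j,ℓ} w(i,j,ℓ) X_i X_j s_ℓ)² ≤ n · (Yᵀ A Y + ∑_{i,j,ℓ} w(i,j,ℓ)²)`.
[Allen–O'Donnell–Witmer 2015, App. A.2, eqs. (normal-cs)–(break-up-sum)] [cite: arXiv150504383, App. A.2] -/
theorem sq_cubicForm_le [DecidableEq I] (w : I → I → Fin n → ℤ) (X : I → ℤ)
    (hX : ∀ i, X i ^ 2 = 1) (s : Fin n → ℤ) (hs : ∀ l, s l ^ 2 = 1) :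
    cubicForm w X s ^ 2 ≤
      (n : ℤ) * (pairSignVec X ⬝ᵥ (oddMatrix w *ᵥ pairSignVec X) + ∑ i, ∑ j, ∑ l, w i j l ^ 2) := by
  rw [dotProduct_oddMatrix_mulVec w X hX, sub_add_cancel, ← sum_lastSlice_sq_eq,
    cubicForm_eq_sum_lastSlice]
  have hcs := Finset.sum_mul_sq_le_sq_mul_sq Finset.univ s (lastSlice w X)
  have hn : ∑ l, s l ^ 2 = (n : ℤ) := by simp [hs]
  rwa [hn] at hcs

/-- `Yᵀ Y = |I|²` for a `±1` vector `X`. [folklore] -/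
theorem pairVec_dotProduct_self (X : I → ℤ) (hX : ∀ i, X i ^ 2 = 1) :
    pairSignVec X ⬝ᵥ pairSignVec X = (Fintype.card I : ℤ) ^ 2 := by
  have h : ∀ p : I × I, pairSignVec X p * pairSignVec X p = 1 := fun p => by
    rw [pairSignVec, mul_mul_mul_comm, ← sq, ← sq, hX, hX, mul_one]
  simp only [dotProduct, h, Finset.sum_const, Finset.card_univ, Fintype.card_prod, nsmul_eq_mul,
    mul_one, Nat.cast_mul, sq]

end Decoupling

/-! ### The odd split of a `k`-SAT instance -/

variable {k n r : ℕ}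

/-- First block of an odd split `f : [r+r+1] ↪ [k]`. [Allen–O'Donnell–Witmer 2015, App. A.2
(`T = (T₁', T₂', i)`)] [folklore] -/
def oddFst (f : Fin (r + r + 1) → Fin k) : Fin r → Fin k := f ∘ Fin.castAdd 1 ∘ Fin.castAdd r

/-- Second block of an odd split. [Allen–O'Donnell–Witmer 2015, App. A.2] [folklore] -/
def oddSnd (f : Fin (r + r + 1) → Fin k) : Fin r → Fin k := f ∘ Fin.castAdd 1 ∘ Fin.natAdd r

/-- Last coordinate of an odd split. [Allen–O'Donnell–Witmer 2015, App. A.2] [folklore] -/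
def oddLast (f : Fin (r + r + 1) → Fin k) : Fin k := f (Fin.natAdd (r + r) 0)

namespace AOWConstraint

/-- Factorisation of the level-`S` term along an odd split:
`∏_{i∈S} z_i = signAt C S · (X(T∘e₁) X(T∘e₂)) · (±1)^{x(T last)}`. [Allen–O'Donnell–Witmer 2015,
App. A.2] [folklore] -/
theorem prod_litSign_image_odd (C : AOWConstraint k n) (x : Fin n → Bool)
    (f : Fin (r + r + 1) → Fin k) (hf : Function.Injective f) :
    ∏ i ∈ univ.image f, C.litSign x i =
      C.signAt (univ.image f) *
        (tensorSign x (C.1 ∘ oddFst f) * tensorSign x (C.1 ∘ oddSnd f) *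
          pmSign (x (C.1 (oddLast f)))) := by
  simp only [litSign, Finset.prod_mul_distrib, signAt]
  rw [mul_comm]
  congr 1
  rw [Finset.prod_image fun i _ j _ h => hf h, Fin.prod_univ_add, Fin.prod_univ_add,
    Fin.prod_univ_one]
  rfl

end AOWConstraint

/-- The single-constraint coefficient tensor: `signAt C S` at `(T∘e₁, T∘e₂, T last)`.
[folklore] -/
def oddEntry (C : AOWConstraint k n) (S : Finset (Fin k)) (f : Fin (r + r + 1) → Fin k)
    (i j : Fin r → Fin n) (l : Fin n) : ℤ :=
  if i = C.1 ∘ oddFst f ∧ j = C.1 ∘ oddSnd f ∧ l = C.1 (oddLast f) then C.signAt S else 0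

/-- **The coefficient tensor `w(i,j,ℓ)`** of the constraint multiset `L` for the odd split `f`:
the signed number of constraints with scope blocks `(i, j, ℓ)`. [Allen–O'Donnell–Witmer 2015,
App. A.2 (`w(T₁', U₁', i)`) with Cor. 4.2 (`w(T) = ∑_c ± 1{(T,c) ∈ I}`)] [cite: arXiv150504383, App. A.2] -/
def oddTensor (L : List (AOWConstraint k n)) (S : Finset (Fin k)) (f : Fin (r + r + 1) → Fin k) :
    (Fin r → Fin n) → (Fin r → Fin n) → Fin n → ℤ :=
  fun i j l => (L.map fun C => oddEntry C S f i j l).sum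

/-- `oddTensor [] = 0`. [folklore] -/
@[simp] theorem oddTensor_nil (S : Finset (Fin k)) (f : Fin (r + r + 1) → Fin k) :
    oddTensor ([] : List (AOWConstraint k n)) S f = 0 := by
  funext i j l
  simp [oddTensor]

/-- `oddTensor (C :: L) = oddEntry C + oddTensor L`. [folklore] -/
theorem oddTensor_cons (C : AOWConstraint k n) (L : List (AOWConstraint k n)) (S : Finset (Fin k))
    (f : Fin (r + r + 1) → Fin k) :
    oddTensor (C :: L) S f = oddEntry (n := n) C S f + oddTensor L S f := by
  funext i j l
  simp [oddTensor]

/-- The cubic form of a single constraint. [folklore] -/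
theorem cubicForm_oddEntry (C : AOWConstraint k n) (S : Finset (Fin k)) (f : Fin (r + r + 1) → Fin k)
    (X : (Fin r → Fin n) → ℤ) (s : Fin n → ℤ) :
    cubicForm (oddEntry (n := n) C S f) X s =
      C.signAt S * (X (C.1 ∘ oddFst f) * X (C.1 ∘ oddSnd f) * s (C.1 (oddLast f))) := by
  unfold cubicForm oddEntry
  rw [Finset.sum_eq_single (C.1 ∘ oddFst f) (fun i _ hi => by simp [hi])
    (fun h => absurd (Finset.mem_univ _) h)]
  rw [Finset.sum_eq_single (C.1 ∘ oddSnd f) (fun j _ hj => by simp [hj])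
    (fun h => absurd (Finset.mem_univ _) h)]
  rw [Finset.sum_eq_single (C.1 (oddLast f)) (fun l _ hl => by simp [hl])
    (fun h => absurd (Finset.mem_univ _) h)]
  simp

/-- **The top-level bias as a cubic form**: for an injective odd split `f`,
`bias_{f([k])}(x) = ∑_{i,j,ℓ} w(i,j,ℓ) X_i X_j x̂_ℓ`. [Allen–O'Donnell–Witmer 2015, App. A.2] [cite: arXiv150504383, App. A.2] -/
theorem bias_image_eq_cubicForm (L : List (AOWConstraint k n)) (x : Fin n → Bool)
    (f : Fin (r + r + 1) → Fin k) (hf : Function.Injective f) :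
    bias L (univ.image f) x =
      cubicForm (oddTensor L (univ.image f) f) (tensorSign x) (fun l => pmSign (x l)) := by
  induction L with
  | nil => simp
  | cons C L ih =>
    rw [bias_cons, oddTensor_cons, cubicForm_add, cubicForm_oddEntry, ← ih,
      C.prod_litSign_image_odd x f hf]

/-- **The computable odd-level test implies the bias bound.** With `w = oddTensor L S f`,
`A = oddMatrix w`, `q = 2^j`, `m = |L|`, `N = n^r`: if
`(2·4^k·n)^{2q} · ((N²)^q (N²)^q tr((AᵀA)^q)) < (m²)^{2q}` and `2·4^k·n·∑ w² < m²`, then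
`2^k |bias_S(x)| < m` for every `x`. [Allen–O'Donnell–Witmer 2015, App. A.2 with App. A.4
(Claim)] [cite: arXiv150504383, App. A.2] -/
theorem two_pow_mul_abs_bias_lt_of_oddCheck (L : List (AOWConstraint k n))
    (f : Fin (r + r + 1) → Fin k) (hf : Function.Injective f) (j : ℕ)
    (h1 : (2 * 4 ^ k * (n : ℤ)) ^ (2 * 2 ^ j) *
        ((((n : ℤ) ^ r) ^ 2) ^ 2 ^ j * (((n : ℤ) ^ r) ^ 2) ^ 2 ^ j *
          (((oddMatrix (oddTensor L (univ.image f) f))ᵀ *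
              oddMatrix (oddTensor L (univ.image f) f)) ^ 2 ^ j).trace) <
      ((L.length : ℤ) ^ 2) ^ (2 * 2 ^ j))
    (h2 : 2 * 4 ^ k * (n : ℤ) *
        ∑ i, ∑ i', ∑ l, oddTensor L (univ.image f) f i i' l ^ 2 < (L.length : ℤ) ^ 2)
    (x : Fin n → Bool) : (2 : ℤ) ^ k * |bias L (univ.image f) x| < L.length := by
  set w := oddTensor L (univ.image f) f with hw
  have hX : ∀ i : Fin r → Fin n, tensorSign x i ^ 2 = 1 := fun i => tensorSign_sq x i
  have hs : ∀ l : Fin n, pmSign (x l) ^ 2 = 1 := fun l => pmSign_sq _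
  -- the spectral part, from the trace test
  have hY : pairSignVec (tensorSign (a := r) x) ⬝ᵥ pairSignVec (tensorSign x) = ((n : ℤ) ^ r) ^ 2 := by
    rw [pairVec_dotProduct_self _ hX, Fintype.card_fun, Fintype.card_fin, Fintype.card_fin]
    push_cast
    ring
  have hA : 2 * 4 ^ k * (n : ℤ) *
      |pairSignVec (tensorSign x) ⬝ᵥ (oddMatrix w *ᵥ pairSignVec (tensorSign x))| < (L.length : ℤ) ^ 2 := by
    refine mul_abs_bilinear_lt_of_trace_lt _ _ _ j (by positivity) (by positivity) ?_
    rw [hY]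
    exact h1
  -- decoupling
  have hdec := sq_cubicForm_le w (tensorSign x) hX (fun l => pmSign (x l)) hs
  rw [← bias_image_eq_cubicForm L x f hf] at hdec
  -- combine: `4^k bias² < m²`
  have hle := le_abs_self (pairSignVec (tensorSign x) ⬝ᵥ (oddMatrix w *ᵥ pairSignVec (tensorSign x)))
  have hn : (0 : ℤ) ≤ n := Nat.cast_nonneg _
  have h4 : (0 : ℤ) ≤ 4 ^ k := by positivity
  have hsq : ((2 : ℤ) ^ k * |bias L (univ.image f) x|) ^ 2 < (L.length : ℤ) ^ 2 := by
    have h22 : ((2 : ℤ) ^ k) ^ 2 = 4 ^ k := by rw [← pow_mul, mul_comm, pow_mul]; norm_num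
    rw [mul_pow, sq_abs, h22]
    nlinarith [mul_le_mul_of_nonneg_left hdec h4, mul_nonneg h4 hn]
  exact lt_of_pow_lt_pow_left₀ 2 (by positivity) hsq

end Literature.Computability.Complexity
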